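import Summits.HodgeConjecture.CorCM.Census.QuarticInversionFaces

/-!
# The quartic inversion twists, IV: the three motions move places and faces

COR-CM (cell `pub-hodgecm2`, stage 2 of the Hodge ladder), count-neutral KERNEL COMBINATORICS by the binder seat b23 (gen 44; claim
QUARTIC-INVERSION, HOME/INBOX.md l.12829).  Part IV of the lane `Census/QuarticInversion*`, on top of parts I–III (`…Model`, `…Hodge`, `…Faces`),
the dicyclic lane's part I (`rev_add_delta`) and seat b09's slice (`tw_add_delta`), all BY NAME.  Bookkeeping definitions with bodies (`plH`, `plY`,
`plT`: the motions on places) + theorems; no `decide` table, no certificate, no named fact, no geometry, no `sorry`.  `Interfaces.lean` (C1), every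
E term, B01, `Transposition/*`, `PortJoin/*` untouched.
HONEST FRAMING: `HC_CM` is NOT proved, here or anywhere in the tree; nothing here is a period, a count of record or a headline.

CONTENT.  The motions of part I act on the places `(k, i)` (`k ∈ {0,1,2,3}` a coset, `i ∈ B`): `h = (a, s) ∈ H₀` by `(k, i) ↦ (k, i − s)`, `y` by
`(k, i) ↦ (σ_y k, −i)` with `σ_y = (0 1)(2 3)`, `t` by `(k, i) ↦ (σ_t k, i)` with `σ_t = (0 2)(1 3)` (§1), and flips are EQUIVARIANT:
`twH₄ g (Θ^{(p)}) = (twH₄ g Θ)^{(g·p)}`, `twY ζ (Θ^{(p)}) = (twY ζ Θ)^{(y·p)}`, `twT (Θ^{(p)}) = (twT Θ)^{(t·p)}` (`twH₄_flipAt`, `twY_flipAt`, `twT_flipAt`).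
Hence (§2) **a translate of a rank-four face is the rank-four face through the moved label at the moved places**:
`translH₄ g (faceVec₄ Θ p q) = faceVec₄ (twH₄ g Θ) (g·p) (g·q)` and likewise `translY_faceVec₄`, `translT_faceVec₄`; the motions on places are
injective, so `p ≠ q` is preserved and **the set of faces `faceSet₄` is stable under all three motions** (`translH₄_mem_faceSet₄`, …) — as is the pair
lattice (part II).  All [folklore] (Pohlmann [Pohlmann1968, Thm 1]).

## References
* [Pohlmann1968] H. Pohlmann, Algebraic cycles on abelian varieties of complex multiplication type, Ann. of Math. 88 (1968), Thm 1.
-/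

namespace Summit.HodgeConjecture.CorCM.Census.QuarticInversion

open Finset
open Summit.HodgeConjecture.CorCM.Census.OddSliceFacesModel
open Summit.HodgeConjecture.CorCM.Census.DicyclicTwist (Ty₂ rev rev_add_delta rev_add_one twH)

noncomputable section

/-! ## §1 The motions on places; flips are equivariant -/

section Places

variable (A : Type) [AddCommGroup A] [DecidableEq A]

/-- The coordinate permutation of `y`: `(0 1)(2 3)`. [folklore] -/
def σY : Fin 4 → Fin 4 := ![1, 0, 3, 2]

/-- The coordinate permutation of `t`: `(0 2)(1 3)`. [folklore] -/
def σT : Fin 4 → Fin 4 := ![2, 3, 0, 1]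

/-- The motion of `h = (a, s) ∈ H₀` on places: `(k, i) ↦ (k, i − s)`. [folklore] -/
def plH (g : ZMod 2 × A) (p : Pl A) : Pl A := (p.1, p.2 - g.2)

/-- The motion of `y` on places: `(k, i) ↦ (σ_y k, −i)`. [folklore] -/
def plY (p : Pl A) : Pl A := (σY p.1, -p.2)

/-- The motion of `t` on places: `(k, i) ↦ (σ_t k, i)`. [folklore] -/
def plT (p : Pl A) : Pl A := (σT p.1, p.2)

omit [DecidableEq A] in
/-- `σ_y` is an involution. [folklore] -/
@[simp] theorem σY_σY (k : Fin 4) : σY (σY k) = k := by fin_cases k <;> rfl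

omit [DecidableEq A] in
/-- `σ_t` is an involution. [folklore] -/
@[simp] theorem σT_σT (k : Fin 4) : σT (σT k) = k := by fin_cases k <;> rfl

omit [DecidableEq A] in
/-- The motion of `h` on places is injective. [folklore] -/
theorem plH_injective (g : ZMod 2 × A) : Function.Injective (plH A g) := fun p q h => by
  obtain ⟨hk, hi⟩ := Prod.mk.inj h
  exact Prod.ext hk (sub_left_injective hi)

omit [DecidableEq A] in
/-- The motion of `y` on places is injective. [folklore] -/
theorem plY_injective : Function.Injective (plY A) := fun p q h => by
  obtain ⟨hk, hi⟩ := Prod.mk.inj h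
  exact Prod.ext (by simpa using congrArg σY hk) (neg_injective hi)

omit [DecidableEq A] [AddCommGroup A] in
/-- The motion of `t` on places is injective. [folklore] -/
theorem plT_injective : Function.Injective (plT A) := fun p q h => by
  obtain ⟨hk, hi⟩ := Prod.mk.inj h
  exact Prod.ext (by simpa using congrArg σT hk) hi

/-- **Flips are `H₀`-equivariant**: `twH₄ g (Θ^{(p)}) = (twH₄ g Θ)^{(g·p)}`. [folklore] -/
theorem twH₄_flipAt (g : ZMod 2 × A) (p : Pl A) (Θ : Ty₄ A) : twH₄ A g (flipAt A p Θ) = flipAt A (plH A g p) (twH₄ A g Θ) := by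
  obtain ⟨k, i⟩ := p
  obtain ⟨⟨ψ₀, ψ₁⟩, ⟨ψ₂, ψ₃⟩⟩ := Θ
  fin_cases k <;> simp [flipAt, plH, twH₄, twH, tw_add_delta]

/-- **Flips are `y`-equivariant**: `twY ζ (Θ^{(p)}) = (twY ζ Θ)^{(y·p)}`. [folklore] -/
theorem twY_flipAt (ζ : ZMod 2) (p : Pl A) (Θ : Ty₄ A) : twY A ζ (flipAt A p Θ) = flipAt A (plY A p) (twY A ζ Θ) := by
  obtain ⟨k, i⟩ := p
  obtain ⟨⟨ψ₀, ψ₁⟩, ⟨ψ₂, ψ₃⟩⟩ := Θ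
  fin_cases k <;> simp [flipAt, plY, σY, twY, twX', rev_add_delta, add_right_comm]

omit [DecidableEq A] [AddCommGroup A] in
/-- `ψ + δ + 1 = ψ + 1 + δ`. [folklore] -/
private theorem add_delta_add_one [DecidableEq A] (ψ : Ty A) (i : A) : ψ + δ A i + 1 = ψ + 1 + δ A i := add_right_comm _ _ _

omit [AddCommGroup A] in
/-- **Flips are `t`-equivariant**: `twT (Θ^{(p)}) = (twT Θ)^{(t·p)}`. [folklore] -/
theorem twT_flipAt (p : Pl A) (Θ : Ty₄ A) : twT A (flipAt A p Θ) = flipAt A (plT A p) (twT A Θ) := by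
  obtain ⟨k, i⟩ := p
  obtain ⟨⟨ψ₀, ψ₁⟩, ⟨ψ₂, ψ₃⟩⟩ := Θ
  fin_cases k <;> simp [flipAt, plT, σT, twT, add_delta_add_one]

omit [DecidableEq A] in
/-- Conjugation commutes with the diagonal motion. [folklore] -/
theorem twH₄_conj₄ (g : ZMod 2 × A) (Θ : Ty₄ A) : twH₄ A g (conj₄ A Θ) = conj₄ A (twH₄ A g Θ) := by
  rw [conj₄_eq_twH₄, conj₄_eq_twH₄, twH₄_twH₄, twH₄_twH₄, add_comm]

omit [DecidableEq A] in
/-- Conjugation commutes with the motion of `y`. [folklore] -/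
theorem twY_conj₄ (ζ : ZMod 2) (Θ : Ty₄ A) : twY A ζ (conj₄ A Θ) = conj₄ A (twY A ζ Θ) := by
  rw [conj₄_eq_twH₄, conj₄_eq_twH₄, twY_twH₄, neg_zero]

omit [DecidableEq A] in
/-- Conjugation commutes with the motion of `t`. [folklore] -/
theorem twT_conj₄ (Θ : Ty₄ A) : twT A (conj₄ A Θ) = conj₄ A (twT A Θ) := by
  rw [conj₄_eq_twH₄, conj₄_eq_twH₄, twT_twH₄]

end Places

/-! ## §2 Translates of faces are faces -/

section Faces

variable (A : Type) [AddCommGroup A] [Fintype A] [DecidableEq A]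

/-- **An `h`-translate of a face is the face through the moved label at the shifted places.** [folklore] -/
theorem translH₄_faceVec₄ (g : ZMod 2 × A) (Θ : Ty₄ A) (p q : Pl A) :
    translH₄ A g (faceVec₄ A Θ p q) = faceVec₄ A (twH₄ A g Θ) (plH A g p) (plH A g q) := by
  show translH₄Hom A g (faceVec₄ A Θ p q) = _
  unfold faceVec₄
  simp only [map_add, translH₄Hom_apply, translH₄_single, twH₄_conj₄, twH₄_flipAt]

/-- **A `y`-translate of a face is the face through the moved label at the moved places.** [folklore] -/
theorem translY_faceVec₄ (ζ : ZMod 2) (Θ : Ty₄ A) (p q : Pl A) :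
    translY A ζ (faceVec₄ A Θ p q) = faceVec₄ A (twY A ζ Θ) (plY A p) (plY A q) := by
  show translYHom A ζ (faceVec₄ A Θ p q) = _
  unfold faceVec₄
  simp only [map_add, translYHom_apply, translY_single, twY_conj₄, twY_flipAt]

/-- **A `t`-translate of a face is the face through the moved label at the moved places.** [folklore] -/
theorem translT_faceVec₄ (Θ : Ty₄ A) (p q : Pl A) :
    translT A (faceVec₄ A Θ p q) = faceVec₄ A (twT A Θ) (plT A p) (plT A q) := by
  show translTHom A (faceVec₄ A Θ p q) = _
  unfold faceVec₄
  simp only [map_add, translTHom_apply, translT_single, twT_conj₄, twT_flipAt]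

/-- **`faceSet₄` is stable under the diagonal motions.** [folklore] -/
theorem translH₄_mem_faceSet₄ (g : ZMod 2 × A) {v : Ty₄ A → ℤ} (hv : v ∈ faceSet₄ A) : translH₄ A g v ∈ faceSet₄ A := by
  obtain ⟨Θ, p, q, hpq, rfl⟩ := hv
  exact ⟨_, _, _, fun h => hpq (plH_injective A g h), translH₄_faceVec₄ A g Θ p q⟩

/-- **`faceSet₄` is stable under the motion of `y`.** [folklore] -/
theorem translY_mem_faceSet₄ (ζ : ZMod 2) {v : Ty₄ A → ℤ} (hv : v ∈ faceSet₄ A) : translY A ζ v ∈ faceSet₄ A := by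
  obtain ⟨Θ, p, q, hpq, rfl⟩ := hv
  exact ⟨_, _, _, fun h => hpq (plY_injective A h), translY_faceVec₄ A ζ Θ p q⟩

/-- **`faceSet₄` is stable under the motion of `t`.** [folklore] -/
theorem translT_mem_faceSet₄ {v : Ty₄ A → ℤ} (hv : v ∈ faceSet₄ A) : translT A v ∈ faceSet₄ A := by
  obtain ⟨Θ, p, q, hpq, rfl⟩ := hv
  exact ⟨_, _, _, fun h => hpq (plT_injective A h), translT_faceVec₄ A Θ p q⟩

omit [DecidableEq A] in
/-- **`pairs₄` is stable under the diagonal motions.** [folklore] -/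
theorem translH₄_mem_pairs₄ (g : ZMod 2 × A) {v : Ty₄ A → ℤ} (hv : v ∈ pairs₄ A) : translH₄ A g v ∈ pairs₄ A := by
  rw [← translH₄Hom_apply]
  refine Submodule.span_induction (p := fun w _ => translH₄Hom A g w ∈ pairs₄ A) ?_ ?_ ?_ ?_ hv
  · rintro _ ⟨Θ, rfl⟩
    rw [translH₄Hom_apply, translH₄_pairVec₄]
    exact Submodule.subset_span ⟨_, rfl⟩
  · rw [map_zero]; exact Submodule.zero_mem _
  · intro x y _ _ hx hy; rw [map_add]; exact Submodule.add_mem _ hx hy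
  · intro n x _ hx; rw [map_smul]; exact Submodule.smul_mem _ n hx

omit [DecidableEq A] in
/-- **`pairs₄` is stable under the motion of `y`.** [folklore] -/
theorem translY_mem_pairs₄ (ζ : ZMod 2) {v : Ty₄ A → ℤ} (hv : v ∈ pairs₄ A) : translY A ζ v ∈ pairs₄ A := by
  rw [← translYHom_apply]
  refine Submodule.span_induction (p := fun w _ => translYHom A ζ w ∈ pairs₄ A) ?_ ?_ ?_ ?_ hv
  · rintro _ ⟨Θ, rfl⟩
    rw [translYHom_apply, translY_pairVec₄]
    exact Submodule.subset_span ⟨_, rfl⟩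
  · rw [map_zero]; exact Submodule.zero_mem _
  · intro x y _ _ hx hy; rw [map_add]; exact Submodule.add_mem _ hx hy
  · intro n x _ hx; rw [map_smul]; exact Submodule.smul_mem _ n hx

omit [DecidableEq A] in
/-- **`pairs₄` is stable under the motion of `t`.** [folklore] -/
theorem translT_mem_pairs₄ {v : Ty₄ A → ℤ} (hv : v ∈ pairs₄ A) : translT A v ∈ pairs₄ A := by
  rw [← translTHom_apply]
  refine Submodule.span_induction (p := fun w _ => translTHom A w ∈ pairs₄ A) ?_ ?_ ?_ ?_ hv
  · rintro _ ⟨Θ, rfl⟩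
    rw [translTHom_apply, translT_pairVec₄]
    exact Submodule.subset_span ⟨_, rfl⟩
  · rw [map_zero]; exact Submodule.zero_mem _
  · intro x y _ _ hx hy; rw [map_add]; exact Submodule.add_mem _ hx hy
  · intro n x _ hx; rw [map_smul]; exact Submodule.smul_mem _ n hx

end Faces

end

end Summit.HodgeConjecture.CorCM.Census.QuarticInversion
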